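import Literature.NumberTheory.EllipticCurves.KernelReductionInertiaProofs
import Literature.NumberTheory.EllipticCurves.SupersingularTorsionValuationTwoProofs
import Literature.NumberTheory.EllipticCurves.KummerInertiaSurjectiveProofs
import Literature.NumberTheory.GaloisRepresentations.IntegralGaloisActionProofs
import Literature.RingTheory.DiscreteValuationRing.AdicCompletionResidueField
import Mathlib.RingTheory.RootsOfUnity.AlgebraicallyClosed
import HarnessLib

/-!
# At an absolutely unramified place of odd residue degree with good supersingular reduction,
# the image of Galois on `E[ℓ]` is not abelian

`Proofs` file (theorems only, no definitions, no named facts), topic `NumberTheory/EllipticCurves`.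
Let `E` be an elliptic curve over a number field `K`, `ℓ` a prime and `v ∣ ℓ` a finite place
with **`e(v ∣ ℓ) = 1`** (`ℓ` is a uniformizer at `v`: `v.valuation K ℓ = exp (-1)`) and **odd
residue degree** (`#(𝓞 K ⧸ v) = ℓᶠ`, `f` odd), at which `E` has a good model `M/𝓞_v` with
**supersingular** reduction (`A_ℓ(M) ∈ 𝔪_v` for odd `ℓ`, `a₁(M) ∈ 𝔪_v` for `ℓ = 2`).  Then
**two elements of `Γ_K` do not commute on
`E[ℓ] = E(K̄)[ℓ]`** (`WeierstrassCurve.exists_smul_smul_ne_of_supersingular_unramified`).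
This is the weak form of Serre, *Propriétés galoisiennes des points d'ordre fini des courbes
elliptiques* (1972), §1.11, Prop. 12 with the remark following it (for `e = 1` supersingular,
inertia acts on `E[ℓ]` through the fundamental character of level `2`, onto a non-split Cartan
subgroup of order `ℓ² - 1`, and a Frobenius of odd degree over `𝔽_ℓ` normalises but does not
centralise it), obtained here without formal groups:

1. (`SupersingularTorsionValuationProofs`, `…TwoProofs`) every `P ∈ E[ℓ] ∖ 0`, transported to
   `M(K̄_v)`, has `|x(P)| = |η|⁻²` where `ηⁿ = ℓ`, `n = ℓ² - 1` (`|ℓ|²|x|ⁿ = 1`);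
2. (`KummerInertiaSurjectiveProofs`) some `σ` in the inertia group `I_𝔓 ≤ Γ_K` has
   `σ η = ζ η`, `ζ` a primitive `n`-th root of unity; for an arithmetic Frobenius `φ` at `𝔓`
   (`exists_isArithFrobAt_of_mem_primesAbove_holds`), `σ' = φ σ φ⁻¹ ∈ I_𝔓` has `σ' η = ζ^q η`
   (`q = #(𝓞 K ⧸ v)`; `φ ζ = ζ^q`, Mathlib `AlgHom.IsArithFrobAt.apply_of_pow_eq_one`, and inertia
   fixes the roots of unity of order prime to `ℓ`);
3. if `Γ_K` acted on `E[ℓ]` through an abelian group, `σ' P = σ P`; comparing `x`-coordinates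
   of the transported points (`u = x(P) η²` is a unit, moved by inertia within `1 + 𝔪`) gives
   `ζ^{2q} ≡ ζ² (mod 𝔓)`, hence `ζ^{2q} = ζ²` and `n ∣ 2(q - 1) = 2(ℓᶠ - 1)` — impossible for
   odd `f` (`2(ℓᶠ - 1) ≡ 2(ℓ - 1) (mod ℓ² - 1)` and `0 < 2(ℓ - 1) < ℓ² - 1`).

## References

* [Serre1972] J.-P. Serre, Invent. Math. 15 (1972), §1.11 (Prop. 12) and §1.3–1.8.
* [SerreAbelianLadic1968] J.-P. Serre, *Abelian ℓ-adic representations and elliptic curves*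
  (1968), IV.2.2.
* [SilvermanAEC2009] J. H. Silverman, *The Arithmetic of Elliptic Curves*, 2nd ed., VII.2–3,
  VIII.1.
-/

noncomputable section

open scoped Classical NNReal NumberField Pointwise
open NumberField IsDedekindDomain Field

universe u

namespace Literature.NumberTheory.EllipticCurves

/-! ## Arithmetic: `ℓ² - 1 ∤ 2(ℓᶠ - 1)` for odd `f` -/

/-- For `ℓ ≥ 2` and `f` odd, `ℓ² - 1` does not divide `2(ℓᶠ - 1)`: modulo `ℓ² - 1` one has
`ℓᶠ ≡ ℓ`, so `2(ℓᶠ - 1) ≡ 2(ℓ - 1)`, and `0 < 2(ℓ - 1) < ℓ² - 1`. [folklore] -/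
theorem not_sq_sub_one_dvd_two_mul_pow_sub_one {ℓ : ℕ} (hℓ : 2 ≤ ℓ) {f : ℕ} (hf : Odd f) :
    ¬ (ℓ ^ 2 - 1 ∣ 2 * (ℓ ^ f - 1)) := by
  obtain ⟨m, rfl⟩ := hf
  intro hdvd
  set A := ℓ ^ (2 * m) with hA
  have hA1 : 1 ≤ A := Nat.one_le_pow _ _ (by omega)
  have hℓA : ℓ ≤ ℓ * A := Nat.le_mul_of_pos_right ℓ hA1
  -- `ℓ^f - 1 = (ℓ - 1) + ℓ (A - 1)`
  have hsplit : ℓ ^ (2 * m + 1) - 1 = (ℓ - 1) + ℓ * (A - 1) := by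
    rw [pow_succ, ← hA, Nat.mul_sub_one, mul_comm]
    omega
  -- `ℓ² - 1 ∣ A - 1`
  have hd : ℓ ^ 2 - 1 ∣ A - 1 := by
    have := Nat.sub_dvd_pow_sub_pow (ℓ ^ 2) 1 m
    rwa [one_pow, ← pow_mul] at this
  rw [hsplit, mul_add] at hdvd
  have hd' : ℓ ^ 2 - 1 ∣ 2 * (ℓ * (A - 1)) := by
    rw [← mul_assoc]
    exact dvd_mul_of_dvd_right hd _
  have h2 : ℓ ^ 2 - 1 ∣ 2 * (ℓ - 1) := by
    have := Nat.dvd_sub hdvd hd'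
    rwa [Nat.add_sub_cancel] at this
  have hle : ℓ ^ 2 - 1 ≤ 2 * (ℓ - 1) := Nat.le_of_dvd (by omega) h2
  have hsq : ℓ * ℓ ≤ 2 * ℓ - 1 := by rw [← pow_two]; omega
  have h2ℓ : 2 * ℓ ≤ ℓ * ℓ := Nat.mul_le_mul_right ℓ hℓ
  exact absurd (h2ℓ.trans hsq) (by omega)

/-! ## Inertia, Frobenius and the roots of unity of order prime to the residue characteristic -/

section Galois

variable {K : Type u} [Field K]

/-- Conjugating an element of the inertia group `I_𝔓` by an element of the decomposition group
(`τ • 𝔓 = 𝔓`) gives an element of `I_𝔓`. [folklore] -/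
theorem conj_mem_inertia_of_smul_eq {𝔓 : Ideal (GaloisRepresentations.absIntegers (𝓞 K) K)}
    {σ τ : absoluteGaloisGroup K} (hσ : σ ∈ 𝔓.inertia (absoluteGaloisGroup K))
    (hτ : τ • 𝔓 = 𝔓) : τ * σ * τ⁻¹ ∈ 𝔓.inertia (absoluteGaloisGroup K) := by
  rw [Ideal.inertia, AddSubgroup.mem_inertia] at hσ ⊢
  intro b
  have h1 : σ • (τ⁻¹ • b) - τ⁻¹ • b ∈ 𝔓 := hσ _
  have h2 : τ • (σ • (τ⁻¹ • b) - τ⁻¹ • b) ∈ τ • 𝔓 := Ideal.smul_mem_pointwise_smul_iff.mpr h1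
  rw [hτ, smul_sub, smul_inv_smul] at h2
  rwa [mul_smul, mul_smul]

/-- **Inertia fixes the roots of unity of order prime to the residue characteristic**: if
`ζⁿ = 1` with `n ∉ 𝔓` and `σ ∈ I_𝔓`, then `σ ζ = ζ` (`σ ζ ≡ ζ (mod 𝔓)` and distinct `n`-th roots
of unity are distinct modulo `𝔓`, `eq_of_pow_eq_one_of_sub_mem`). [cite: Serre1972, §1.3] -/
theorem smul_eq_self_of_pow_eq_one_of_mem_inertia
    {𝔓 : Ideal (GaloisRepresentations.absIntegers (𝓞 K) K)} [𝔓.IsPrime] {n : ℕ}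
    (hn𝔓 : ((n : ℕ) : GaloisRepresentations.absIntegers (𝓞 K) K) ∉ 𝔓)
    {ζ : GaloisRepresentations.absIntegers (𝓞 K) K} (hζ : ζ ^ n = 1)
    {σ : absoluteGaloisGroup K} (hσ : σ ∈ 𝔓.inertia (absoluteGaloisGroup K)) : σ • ζ = ζ := by
  rw [Ideal.inertia, AddSubgroup.mem_inertia] at hσ
  have h1 : (σ • ζ) ^ n = 1 := by rw [← smul_pow', hζ, smul_one]
  exact eq_of_pow_eq_one_of_sub_mem hn𝔓 h1 hζ (hσ ζ)

end Galois

end Literature.NumberTheory.EllipticCurves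

/-! ## The non-commutation theorem -/

namespace WeierstrassCurve

open Literature.NumberTheory.EllipticCurves Literature.NumberTheory.GaloisRepresentations Field
  IsDedekindDomain.HeightOneSpectrum

variable {K : Type u} [Field K] [NumberField K] (W : WeierstrassCurve K)

/-- **Serre 1972, §1.11 (Prop. 12, `e = 1`, supersingular, odd residue degree): two elements of
`Γ_K` do not commute on `E[ℓ]`.**  Hypotheses: `E/K` elliptic over a number field, `ℓ` a
prime, `v` a finite place at which `ℓ` is a uniformizer (`v ∣ ℓ`, `e(v ∣ ℓ) = 1`) with residue
field of odd degree `f` over `𝔽_ℓ`, and a good model `M/𝓞_v` of `E` at `v` (`C • E_{K_v} = M_{K_v}`,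
`Δ(M) ∈ 𝓞_vˣ`) with supersingular reduction (`a₁(M) ∈ 𝔪_v` if `ℓ = 2`, `A_ℓ(M) ∈ 𝔪_v` otherwise).
Conclusion: there are
`σ, τ ∈ Γ_K` and `P ∈ E[ℓ]` with `σ τ P ≠ τ σ P`.  See the module docstring for the proof.
[cite: Serre1972, §1.11 Prop. 12] [cite: SerreAbelianLadic1968, IV.2.2] -/
theorem exists_smul_smul_ne_of_supersingular_unramified [W.IsElliptic]
    {v : HeightOneSpectrum (𝓞 K)} {ℓ : ℕ} [hℓ : Fact ℓ.Prime]
    (hℓv : v.valuation K (ℓ : K) = WithZero.exp (-1 : ℤ))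
    {f : ℕ} (hf : Odd f) (hq : Nat.card (𝓞 K ⧸ v.asIdeal) = ℓ ^ f)
    {C : VariableChange (v.adicCompletion K)} {M : WeierstrassCurve (v.adicCompletionIntegers K)}
    (hCM : C • W.baseChange (v.adicCompletion K) =
      M.map (algebraMap (v.adicCompletionIntegers K) (v.adicCompletion K))) (hΔ : IsUnit M.Δ)
    (hA : (if ℓ = 2 then M.a₁ else M.hasseCoeff ℓ) ∈
      IsLocalRing.maximalIdeal (v.adicCompletionIntegers K)) :
    ∃ (σ τ : absoluteGaloisGroup K) (P : geomPoints W), P ∈ geomTorsion W ℓ ∧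
      σ • τ • P ≠ τ • σ • P := by
  -- ### `v ∣ ℓ`, `n = ℓ² - 1 ∉ v`
  have hℓmem : (ℓ : 𝓞 K) ∈ v.asIdeal := by
    apply (v.valuation_lt_one_iff_mem (K := K) (ℓ : 𝓞 K)).mp
    change v.valuation K (algebraMap (𝓞 K) K (ℓ : 𝓞 K)) < 1
    rw [map_natCast, hℓv, ← WithZero.exp_zero, WithZero.exp_lt_exp]
    norm_num
  set n : ℕ := ℓ ^ 2 - 1 with hndef
  have hℓ2' : 2 ≤ ℓ := hℓ.out.two_le
  have hn0 : 0 < n := by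
    have : 2 ^ 2 ≤ ℓ ^ 2 := Nat.pow_le_pow_left hℓ2' 2
    omega
  have hnv : (n : 𝓞 K) ∉ v.asIdeal := by
    intro hmem
    have h1 : ((ℓ ^ 2 : ℕ) : 𝓞 K) ∈ v.asIdeal := by
      rw [Nat.cast_pow]
      exact Ideal.pow_mem_of_mem v.asIdeal hℓmem 2 two_pos
    have h2 : ((ℓ ^ 2 : ℕ) : 𝓞 K) - (n : 𝓞 K) = 1 := by
      rw [← Nat.cast_sub (by omega), show ℓ ^ 2 - n = 1 by omega, Nat.cast_one]
    have : (1 : 𝓞 K) ∈ v.asIdeal := h2 ▸ v.asIdeal.sub_mem h1 hmem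
    exact v.isPrime.ne_top ((Ideal.eq_top_iff_one _).mpr this)
  -- ### a primitive `n`-th root of unity `ζ` and an `n`-th root `η` of `ℓ` in `K̄`
  set Ω := AlgebraicClosure K
  haveI : NeZero ((n : ℕ) : K) := ⟨Nat.cast_ne_zero.mpr hn0.ne'⟩
  obtain ⟨ζ, hζ⟩ := HasEnoughRootsOfUnity.exists_primitiveRoot Ω n
  obtain ⟨η, hη⟩ := IsAlgClosed.exists_pow_nat_eq (algebraMap K Ω ℓ) hn0
  have hη0 : η ≠ 0 := by
    rintro rfl
    rw [zero_pow hn0.ne', eq_comm, map_eq_zero] at hη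
    exact (Nat.cast_ne_zero.mpr hℓ.out.ne_zero) hη
  have hζ0 : ζ ≠ 0 := hζ.ne_zero hn0.ne'
  -- integrality
  set S := absIntegers (𝓞 K) K with hS
  have hζint : ζ ∈ S := by
    rw [hS, absIntegers, mem_integralClosure_iff]
    exact IsIntegral.of_pow hn0 (by rw [hζ.pow_eq_one]; exact isIntegral_one)
  set z : S := ⟨ζ, hζint⟩ with hzdef
  have hz : z ^ n = 1 := Subtype.ext (by
    change ζ ^ n = 1
    exact hζ.pow_eq_one)
  -- ### a prime `𝔓 ∣ v` of `\bar ℤ_K`, a Frobenius `φ` and an inertia element `σ` with `σ η = ζ η`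
  obtain ⟨𝔓, h𝔓⟩ := HeightOneSpectrum.primesAbove_nonempty v
  haveI := h𝔓.1
  haveI := h𝔓.2
  obtain ⟨φ, hφ⟩ := HeightOneSpectrum.exists_isArithFrobAt_of_mem_primesAbove_holds h𝔓
  have hφ𝔓 : φ • 𝔓 = 𝔓 := hφ.mem_stabilizer
  set q : ℕ := Nat.card (𝓞 K ⧸ v.asIdeal) with hqdef
  have hq' : Nat.card (𝓞 K ⧸ 𝔓.under (𝓞 K)) = q := by
    rw [hqdef, ← h𝔓.2.over]
  have hn𝔓 : ((n : ℕ) : S) ∉ 𝔓 := by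
    intro hmem
    apply hnv
    have h1 : algebraMap (𝓞 K) S (n : 𝓞 K) ∈ 𝔓 := by rwa [map_natCast]
    rw [← Ideal.mem_comap] at h1
    change (n : 𝓞 K) ∈ 𝔓.under (𝓞 K) at h1
    rwa [← h𝔓.2.over] at h1
  -- `φ ζ = ζ^q`
  have hφζ : φ • ζ = ζ ^ q := by
    have h1 := AlgHom.IsArithFrobAt.apply_of_pow_eq_one hφ hz hn𝔓
    rw [hq'] at h1
    have h3 : (((MulSemiringAction.toAlgHom (𝓞 K) S φ) z : S) : Ω) = φ • ζ := rfl
    have h4 : ((z ^ q : S) : Ω) = ζ ^ q := rfl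
    rw [← h3, ← h4]
    exact congrArg Subtype.val h1
  obtain ⟨σ, hσI, hση⟩ :=
    exists_mem_absoluteGaloisGroup_inertia_smul_eq_pow_mul hn0 hζ v hnv hℓv hη h𝔓 1
  rw [pow_one] at hση
  -- ### `σ' = φ σ φ⁻¹ ∈ I_𝔓` with `σ' η = ζ^q η`
  set σ' : absoluteGaloisGroup K := φ * σ * φ⁻¹ with hσ'def
  have hσ'I : σ' ∈ 𝔓.inertia (absoluteGaloisGroup K) := conj_mem_inertia_of_smul_eq hσI hφ𝔓
  have hσ'η : σ' • η = ζ ^ q * η := by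
    -- `φ⁻¹ η = ζ₁ η` for an `n`-th root of unity `ζ₁`, fixed by `σ`
    have hφη : ((φ⁻¹ • η) / η) ^ n = 1 := by
      rw [div_pow, ← smul_pow', hη, div_eq_one_iff_eq (by rw [← hη]; exact pow_ne_zero _ hη0)]
      exact smul_algebraMap φ⁻¹ (ℓ : K)
    set ζ₁ : Ω := (φ⁻¹ • η) / η with hζ₁def
    have hζ₁int : ζ₁ ∈ S := by
      rw [hS, absIntegers, mem_integralClosure_iff]
      exact IsIntegral.of_pow hn0 (by rw [hφη]; exact isIntegral_one)
    have hσζ₁ : σ • ζ₁ = ζ₁ := by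
      have := smul_eq_self_of_pow_eq_one_of_mem_inertia hn𝔓 (ζ := ⟨ζ₁, hζ₁int⟩)
        (Subtype.ext (by change ζ₁ ^ n = 1; exact hφη)) hσI
      exact congrArg (fun t : S ↦ (t : Ω)) this
    have hφ1 : φ⁻¹ • η = ζ₁ * η := by rw [hζ₁def, div_mul_cancel₀ _ hη0]
    have hησ : σ • (φ⁻¹ • η) = ζ₁ * (ζ * η) := by
      rw [hφ1, smul_mul', hσζ₁, hση]
    -- apply `φ`
    have hφζ₁η : φ • (ζ₁ * η) = η := by rw [← hφ1, smul_inv_smul]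
    calc σ' • η = φ • (σ • (φ⁻¹ • η)) := by rw [hσ'def, mul_smul, mul_smul]
      _ = φ • (ζ * (ζ₁ * η)) := by rw [hησ, mul_left_comm]
      _ = (φ • ζ) * (φ • (ζ₁ * η)) := smul_mul' φ ζ (ζ₁ * η)
      _ = ζ ^ q * η := by rw [hφζ, hφζ₁η]
  -- ### suppose all pairs of elements of `Γ_K` commute on `E[ℓ]`
  by_contra hall
  push Not at hall
  -- a non-zero `P₀ ∈ E[ℓ]`
  have hℓΩ : ((ℓ : ℕ) : Ω) ≠ 0 := Nat.cast_ne_zero.mpr hℓ.out.ne_zero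
  have hcardT : Nat.card (geomTorsion W ((ℓ : ℕ) : ℤ)) = ℓ ^ 2 :=
    (W.baseChange Ω).card_torsionBy_eq_sq hℓΩ
  haveI : Finite (geomTorsion W ((ℓ : ℕ) : ℤ)) := by
    apply Nat.finite_of_card_ne_zero
    rw [hcardT]
    exact pow_ne_zero 2 hℓ.out.ne_zero
  have hnt : Nontrivial (geomTorsion W ((ℓ : ℕ) : ℤ)) := by
    rw [← Finite.one_lt_card_iff_nontrivial, hcardT]
    exact Nat.one_lt_pow two_ne_zero hℓ.out.one_lt
  obtain ⟨⟨P₀, hP₀⟩, hP₀ne⟩ := exists_ne (0 : geomTorsion W ((ℓ : ℕ) : ℤ))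
  have hP₀0 : P₀ ≠ 0 := fun h ↦ hP₀ne (Subtype.ext h)
  have hP₀ℓ : ((ℓ : ℕ) : ℤ) • P₀ = 0 := (Submodule.mem_torsionBy_iff _ P₀).mp hP₀
  -- `σ' P₀ = σ P₀`
  have hσ'P : σ' • P₀ = σ • P₀ := by
    have h1 : σ • φ⁻¹ • P₀ = φ⁻¹ • σ • P₀ := hall σ φ⁻¹ P₀ hP₀
    rw [hσ'def, mul_smul, mul_smul, h1, smul_inv_smul]
  -- ### local set-up at `v`: `𝔓 = 𝔓_{ι,𝔐}`, local lifts of `σ`, `σ'`, the valuation `w`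
  obtain ⟨𝔐, h𝔐⟩ := v.localPrimesAbove_nonempty
  obtain ⟨g, hg⟩ := HeightOneSpectrum.exists_smul_eq_of_mem_primesAbove_holds
    (HeightOneSpectrum.primeBelow_mem_primesAbove
      (ι := closureEmb (K := K) (v.adicCompletion K)) h𝔐) h𝔓
  set ι : Ω →ₐ[K] AlgebraicClosure (v.adicCompletion K) :=
    (closureEmb (K := K) (v.adicCompletion K)).comp
      ((show Ω ≃ₐ[K] Ω from g⁻¹) : Ω →ₐ[K] Ω) with hι
  have h𝔓ι : 𝔓 = v.primeBelow ι 𝔐 := by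
    rw [hι, HeightOneSpectrum.primeBelow_comp, ← hg]
    exact congrArg (· • _) (inv_inv g).symm
  have hσIι : σ ∈ (v.primeBelow ι 𝔐).inertia (absoluteGaloisGroup K) := h𝔓ι ▸ hσI
  have hσ'Iι : σ' ∈ (v.primeBelow ι 𝔐).inertia (absoluteGaloisGroup K) := h𝔓ι ▸ hσ'I
  obtain ⟨τ, hτI, hτ⟩ :=
    IsDedekindDomain.HeightOneSpectrum.exists_mem_inertia_apply_eq_holds v ι h𝔐 hσIι
  obtain ⟨τ', hτ'I, hτ'⟩ :=
    IsDedekindDomain.HeightOneSpectrum.exists_mem_inertia_apply_eq_holds v ι h𝔐 hσ'Iι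
  have hres : resGalOfEmb ι τ = σ := resGalOfEmb_eq_of_apply_eq ι hτ
  have hres' : resGalOfEmb ι τ' = σ' := resGalOfEmb_eq_of_apply_eq ι hτ'
  obtain ⟨w, hw⟩ := v.exists_spectralValuation
  set E := v.adicCompletion K
  set L := AlgebraicClosure (v.adicCompletion K)
  set σE : L ≃ₐ[E] L := absoluteGaloisGroup.toAlgEquiv _ τ with hσE
  set σE' : L ≃ₐ[E] L := absoluteGaloisGroup.toAlgEquiv _ τ' with hσE'
  have hσ₂ : ∀ z : L, w z ≤ 1 → w (σE z - z) < 1 :=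
    (mem_inertia_iff_spectralValuation hw h𝔐).mp hτI
  have hσ₂' : ∀ z : L, w z ≤ 1 → w (σE' z - z) < 1 :=
    (mem_inertia_iff_spectralValuation hw h𝔐).mp hτ'I
  -- ### transport `E(K̄) → M(K̄_v)`, equivariantly
  haveI hint := isIntegral_spectralValuation_baseChange hw M
  have hCM' := congrArg (fun X : WeierstrassCurve E ↦ X.baseChange L) hCM
  let Φ : localPoints W E ≃+ ((M.map (algebraMap (v.adicCompletionIntegers K) E)).baseChange L).toAffine.Point :=
    ((Affine.Point.congrEquiv (baseChange_baseChange_adicCompletion W v).symm).trans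
      (VariableChange.pointEquivBaseChange (W.baseChange E) C L)).trans
      (Affine.Point.congrEquiv hCM')
  have hΦ : ∀ (ρ : absoluteGaloisGroup E) (Q : localPoints W E),
      Φ (ρ • Q) = Affine.Point.map ((absoluteGaloisGroup.toAlgEquiv _ ρ : L ≃ₐ[E] L) : L →ₐ[E] L)
        (Φ Q) := by
    intro ρ Q
    change Affine.Point.congrEquiv hCM' (VariableChange.pointEquivBaseChange (W.baseChange E) C L
        (Affine.Point.congrEquiv (baseChange_baseChange_adicCompletion W v).symm (ρ • Q))) =
      Affine.Point.map ((absoluteGaloisGroup.toAlgEquiv _ ρ : L ≃ₐ[E] L) : L →ₐ[E] L)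
        (Affine.Point.congrEquiv hCM' (VariableChange.pointEquivBaseChange (W.baseChange E) C L
          (Affine.Point.congrEquiv (baseChange_baseChange_adicCompletion W v).symm Q)))
    rw [congrEquiv_smul, VariableChange.pointEquivBaseChange_map_algEquiv]
    exact Affine.Point.congrEquiv_baseChange_map hCM _ _
  set Ψ : geomPoints W →+ ((M.map (algebraMap (v.adicCompletionIntegers K) E)).baseChange L).toAffine.Point :=
    Φ.toAddMonoidHom.comp (pointsMapOfEmb W ι) with hΨ
  have hΨinj : Function.Injective Ψ := Φ.injective.comp (pointsMapOfEmb_injective W ι)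
  have hΨσ : Ψ (σ • P₀) = Affine.Point.map (σE : L →ₐ[E] L) (Ψ P₀) := by
    rw [hΨ, AddMonoidHom.coe_comp, Function.comp_apply, ← hres, pointsMapOfEmb_smul W ι τ P₀]
    exact hΦ τ _
  have hΨσ' : Ψ (σ' • P₀) = Affine.Point.map (σE' : L →ₐ[E] L) (Ψ P₀) := by
    rw [hΨ, AddMonoidHom.coe_comp, Function.comp_apply, ← hres', pointsMapOfEmb_smul W ι τ' P₀]
    exact hΦ τ' _
  -- `Ψ P₀ = (x, y)` is affine, killed by `ℓ`
  obtain ⟨xM, yM, hxy, hΨP⟩ : ∃ x y h, Ψ P₀ = Affine.Point.some x y h := by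
    rcases hP : Ψ P₀ with _ | ⟨x, y, h⟩
    · exfalso
      apply hP₀0
      apply hΨinj
      rw [map_zero]
      exact hP
    · exact ⟨x, y, h, rfl⟩
  have hℓΨ : (ℓ : ℤ) • (Affine.Point.some xM yM hxy) = 0 := by
    rw [← hΨP, ← map_zsmul, hP₀ℓ, map_zero]
  -- ### the valuation of `x(Ψ P₀)`: `|x| > 1`, `|ℓ| |x|^{n/2} = 1`
  have hℓL : (ℓ : L) ≠ 0 := by
    rw [← map_natCast (algebraMap K L) ℓ]
    exact (map_ne_zero_iff _ (algebraMap K L).injective).mpr (Nat.cast_ne_zero.mpr hℓ.out.ne_zero)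
  have hℓw : w (ℓ : L) < 1 := spectralValuation_natCast_lt_one hw hℓmem
  -- `Valued.v ℓ = exp (-1)` on `K_v`, so `𝔪_v ⊆ ℓ 𝓞_v`
  have hvℓ : Valued.v ((ℓ : (v.adicCompletionIntegers K)) : E) = WithZero.exp (-1 : ℤ) := by
    have e1 : ((ℓ : (v.adicCompletionIntegers K)) : E) = ((ℓ : K) : E) := by
      rw [show ((ℓ : (v.adicCompletionIntegers K)) : E) = algebraMap (v.adicCompletionIntegers K) E ℓ from rfl, map_natCast,
        show ((ℓ : K) : E) = algebraMap K E ℓ from rfl, map_natCast]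
    rw [e1, valuedAdicCompletion_eq_valuation', hℓv]
  have hgen : ∀ c ∈ IsLocalRing.maximalIdeal (v.adicCompletionIntegers K), (ℓ : (v.adicCompletionIntegers K)) ∣ c := by
    intro c hc
    rw [HeightOneSpectrum.mem_maximalIdeal_adicCompletionIntegers_iff] at hc
    have hc' : Valued.v (c : E) ≤ WithZero.exp (-1 : ℤ) := by
      rcases eq_or_ne (Valued.v (c : E)) 0 with h0 | h0
      · rw [h0]; exact zero_le
      · obtain ⟨a, ha⟩ : ∃ a : ℤ, Valued.v (c : E) = WithZero.exp a :=
          ⟨WithZero.log (Valued.v (c : E)), (WithZero.exp_log h0).symm⟩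
        rw [ha] at hc ⊢
        rw [← WithZero.exp_zero, WithZero.exp_lt_exp] at hc
        rw [WithZero.exp_le_exp]
        omega
    have hℓE : ((ℓ : (v.adicCompletionIntegers K)) : E) ≠ 0 := by
      intro h0
      rw [h0, map_zero] at hvℓ
      exact WithZero.coe_ne_zero hvℓ.symm
    have hmem : (c : E) / ((ℓ : (v.adicCompletionIntegers K)) : E) ∈ v.adicCompletionIntegers K := by
      rw [HeightOneSpectrum.mem_adicCompletionIntegers, map_div₀, hvℓ]
      exact div_le_one_of_le₀ hc' zero_le
    refine ⟨⟨(c : E) / ((ℓ : (v.adicCompletionIntegers K)) : E), hmem⟩, Subtype.ext ?_⟩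
    change (c : E) = ((ℓ : (v.adicCompletionIntegers K)) : E) * ((c : E) / ((ℓ : (v.adicCompletionIntegers K)) : E))
    rw [mul_div_cancel₀ _ hℓE]
  -- the residue field of `𝓞_v` is finite of characteristic `ℓ`
  haveI : CharP (IsLocalRing.ResidueField (v.adicCompletionIntegers K)) ℓ := by
    apply (CharP.charP_iff_prime_eq_zero hℓ.out).mpr
    rw [← map_natCast (IsLocalRing.residue (v.adicCompletionIntegers K)) ℓ, IsLocalRing.residue_eq_zero_iff,
      HeightOneSpectrum.mem_maximalIdeal_adicCompletionIntegers_iff, hvℓ, ← WithZero.exp_zero,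
      WithZero.exp_lt_exp]
    norm_num
  -- the shape of `ψ_ℓ(M)`, transported to `V = M_L`
  haveI : Finite (𝓞 K ⧸ v.asIdeal) := by
    apply Nat.finite_of_card_ne_zero
    rw [← HeightOneSpectrum.residueCard_eq_card_quotient]
    exact Nat.ne_zero_of_lt (HeightOneSpectrum.one_lt_residueCard v)
  haveI : Finite (IsLocalRing.ResidueField (v.adicCompletionIntegers K)) :=
    IsDedekindDomain.HeightOneSpectrum.finite_residueField_adicCompletionIntegers K v
  have hR : ∀ c : v.adicCompletionIntegers K,
      w (((algebraMap E L).comp (algebraMap (v.adicCompletionIntegers K) E)) c) ≤ 1 :=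
    fun c ↦ (spectralValuation_algebraMap_le_one_iff hw _).mpr c.2
  obtain ⟨h1x, hkey⟩ := one_lt_valuation_X_of_prime_zsmul_eq_zero_of_supersingular
    ((algebraMap E L).comp (algebraMap (v.adicCompletionIntegers K) E)) hR hgen hℓw hℓL M hΔ hA hℓΨ
  -- ### `ηᵥ = ι η`, `ζᵥ = ι ζ`: `|ηᵥ|ⁿ = |ℓ|`, `|ζᵥ| = 1`, `u = x ηᵥ²` is a unit
  set ηv : L := ι η with hηv
  set ζv : L := ι ζ with hζv
  have hηv0 : ηv ≠ 0 := (map_ne_zero_iff ι ι.injective).mpr hη0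
  have hζv0 : ζv ≠ 0 := (map_ne_zero_iff ι ι.injective).mpr hζ0
  have hηvn : w ηv ^ n = w (ℓ : L) := by
    rw [← map_pow, hηv, ← map_pow, hη, AlgHom.commutes, map_natCast]
  have hζvn : ζv ^ n = 1 := by rw [hζv, ← map_pow, hζ.pow_eq_one, map_one]
  have hζv1 : w ζv = 1 := by
    have := congrArg w hζvn
    rw [map_pow, map_one] at this
    exact (pow_eq_one_iff.mp this).resolve_right hn0.ne'
  set u : L := xM * ηv ^ 2 with hu
  have hwu : w u = 1 := by
    have h1 : (w xM * w ηv ^ 2) ^ n = 1 := by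
      rw [mul_pow, ← pow_mul, mul_comm 2 n, pow_mul, hηvn, mul_comm]
      exact hkey
    rw [hu, map_mul, map_pow]
    exact (pow_eq_one_iff.mp h1).resolve_right hn0.ne'
  -- `σE ηᵥ = ζᵥ ηᵥ`, `σE' ηᵥ = ζᵥ^q ηᵥ`
  have hσEη : σE ηv = ζv * ηv := by
    change τ • ι η = ι ζ * ι η
    rw [← hτ η, hση, map_mul]
  have hσE'η : σE' ηv = ζv ^ q * ηv := by
    change τ' • ι η = ι ζ ^ q * ι η
    rw [← hτ' η, hσ'η, map_mul, map_pow]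
  -- `σE' x = σE x` from `σ' P₀ = σ P₀`
  have hX : σE' xM = σE xM := by
    have h1 : Ψ (σ' • P₀) = Ψ (σ • P₀) := by rw [hσ'P]
    rw [hΨσ, hΨσ', hΨP, Affine.Point.map_some, Affine.Point.map_some] at h1
    exact (Affine.Point.some.injEq _ _ _ _ _ _ |>.mp h1).1
  -- ### `u (ζᵥ^{2q} - ζᵥ²)` is small, hence `ζᵥ^{2q} ≡ ζᵥ² (mod 𝔐)`
  have hid : σE u * ζv ^ (2 * q) = σE' u * ζv ^ 2 := by
    rw [hu, map_mul, map_mul, map_pow, map_pow, hσEη, hσE'η, hX]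
    ring
  have hsmall : w (ζv ^ (2 * q) - ζv ^ 2) < 1 := by
    have hxM1 : w xM ≠ 0 := ne_of_gt (lt_trans zero_lt_one h1x)
    have hwu1 : w u ≤ 1 := hwu.le
    have e : u * (ζv ^ (2 * q) - ζv ^ 2) =
        (u - σE u) * ζv ^ (2 * q) - (u - σE' u) * ζv ^ 2 := by
      linear_combination hid
    have h2 : w (u * (ζv ^ (2 * q) - ζv ^ 2)) < 1 := by
      rw [e]
      refine Valuation.map_sub_lt _ ?_ ?_
      · rw [map_mul, map_pow, hζv1, one_pow, mul_one, ← Valuation.map_neg, neg_sub]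
        exact hσ₂ u hwu1
      · rw [map_mul, map_pow, hζv1, one_pow, mul_one, ← Valuation.map_neg, neg_sub]
        exact hσ₂' u hwu1
    rwa [map_mul, hwu, one_mul] at h2
  -- in `\bar ℤ_K`: `ζ^{2q} - ζ² ∈ 𝔓`
  have hmemP : z ^ (2 * q) - z ^ 2 ∈ 𝔓 := by
    rw [h𝔓ι, HeightOneSpectrum.mem_primeBelow_iff, mem_iff_spectralValuation_lt_one hw h𝔐,
      HeightOneSpectrum.coe_absIntegersToLocal_apply]
    have : ((z ^ (2 * q) - z ^ 2 : S) : Ω) = ζ ^ (2 * q) - ζ ^ 2 := rfl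
    rw [this, map_sub, map_pow, map_pow]
    exact hsmall
  have hzq : z ^ (2 * q) = z ^ 2 := by
    refine eq_of_pow_eq_one_of_sub_mem hn𝔓 ?_ ?_ hmemP
    · rw [← pow_mul, mul_comm, pow_mul, hz, one_pow]
    · rw [← pow_mul, mul_comm, pow_mul, hz, one_pow]
  have hζq : ζ ^ (2 * q) = ζ ^ 2 := by
    have := congrArg Subtype.val hzq
    exact this
  -- ### `n ∣ 2 (q - 1)`: contradiction
  have hq1 : 1 ≤ q := by
    rw [hq]
    exact Nat.one_le_pow _ _ hℓ.out.pos
  have hζpow : ζ ^ (2 * q - 2) = 1 := by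
    have h1 : ζ ^ 2 * ζ ^ (2 * q - 2) = ζ ^ 2 * 1 := by
      rw [← pow_add, show 2 + (2 * q - 2) = 2 * q by omega, mul_one, hζq]
    exact mul_left_cancel₀ (pow_ne_zero 2 hζ0) h1
  have hdvd : n ∣ 2 * (ℓ ^ f - 1) := by
    have := hζ.dvd_of_pow_eq_one _ hζpow
    rwa [show 2 * q - 2 = 2 * (ℓ ^ f - 1) by rw [hq]; omega] at this
  exact not_sq_sub_one_dvd_two_mul_pow_sub_one hℓ2' hf hdvd

end WeierstrassCurve

end
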